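/-
Copyright: the b2b-balaban T⁴-continuum CRUX team, row NE7b leaf lineage `t4-ne7b-formalise-leaf-03` (gen 140). Project licence.
-/
import Summits.QuantumFields.BalabanUV.T4Continuum.Spine.NE7b.ConvexWindowMass
import Summits.QuantumFields.BalabanUV.T4Continuum.Spine.NE7b.ConvexMinimiser

/-!
# JUNCTION: the OWNER's ball-mass letter `…ConvexWindowMass.ballMass_ge_of_pinch` with its `x₀ ∕ hlow` binders SUPPLIED by
# `…ConvexMinimiser` and `hup` derived from the UPPER first-order letter (row NE7b, node U5c; kernel lemmas of real analysis)

Cell `pub-balaban`, sub-cell `t4`, spine estimate NE7b (`T4WeightBudget.RelWeightBound`; the cell's OWN estimate — NOT PRINTED in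
[Bałaban 1983–89], NOT PROVED).  Crux-route work under `Spine/NE7b/` by a row leaf on the convexity road; NOTHING of Bałaban's is named
or asserted; no `T4Continuum/Support` leaf typed; no `def`; zero `sorry`.

WHY.  `…ConvexWindowMass.ballMass_ge_of_pinch` (the `hmass` letter of the convexity road for a Euclidean BALL, two-sided pinch model)
DISPLAYS a centre `x₀` and the two pinches AT `x₀`: `hlow : V x₀ + (λ∕2)‖y − x₀‖² ≤ V y`, `hup : V y ≤ V x₀ + (Λ∕2)‖y − x₀‖²`.
`…ConvexMinimiser.exists_minimiser_of_firstOrder` SUPPLIES `x₀` (the unique critical point = minimiser) and `hlow` from the road's own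
first-order `λ`-convexity letter; THIS FILE composes the two BY NAME and derives `hup` at the (existential) critical point from the UPPER
first-order letter `V y ≤ V x + ⟪∇V x, y − x⟫ + (Λ∕2)‖y − x‖²` (`Λ`-smoothness), stated for ALL `x, y` so that a consumer need not know
`x₀`.

WHAT IS PROVED ([folklore]): `forall_upperPinch_of_gradient_eq_zero`, **`exists_ballMass_ge_of_firstOrder_pinch`**
(`∃ x₀, ∇V x₀ = 0 ∧ (1 − η)·∫e^{−V} ≤ ∫_{‖y − x₀‖ < R} e^{−V}`, `η = e^{−λR²∕4}(π∕(λ∕4))^{d∕2}∕(π∕(Λ∕2))^{d∕2}` — the OWNER's (10) with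
two of its three displayed letters discharged and the third globalised).

NOT HERE (honest): the constants `λ`, `Λ`, `R` of Bałaban's exponents and windows ((A1c) readings; π-ne7bref-g70-1's Δ4-class
extension letters in print's currency); anything of Bałaban's.  NE7b NOT PRINTED ∕ NOT PROVED; spine PROVED 0∕9; rung (B)+1 on a FINITE
torus — NOT infinite volume, NOT the mass gap, NOT Clay.
HONEST DEPENDENCY: continuum YM on T⁴ ⇐ BetaPertH ∧ nine spine estimates (0/9 proved); BetaPertH ⇐ (D1) ∧ (D4) ∧ CAP+tail; G-an2-4
gates asym, D1 and NE2/3/4.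
-/

set_option autoImplicit false

noncomputable section

open MeasureTheory Real
open scoped RealInnerProductSpace

namespace Summit.QuantumFields.BalabanUV.T4Continuum.NE7b.ConvexMinimiserBall

open Summit.QuantumFields.BalabanUV.T4Continuum.NE7b.ConvexMinimiser

variable {n : ℕ}

/-! ## The OWNER's ball-mass letter with `x₀`, `hlow` supplied and `hup` from the upper first-order letter -/

/-- **UPPER PINCH AT A CRITICAL POINT FROM `Λ`-SMOOTHNESS**: `V y ≤ V x + ⟪∇V x, y − x⟫ + (Λ∕2)‖y − x‖²` for all `x, y` and
`∇V x₀ = 0` give `V y ≤ V x₀ + (Λ∕2)‖y − x₀‖²`. [folklore] -/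
theorem forall_upperPinch_of_gradient_eq_zero {V : EuclideanSpace ℝ (Fin n) → ℝ} {Lam : ℝ} {x₀ : EuclideanSpace ℝ (Fin n)}
    (hVup : ∀ x y : EuclideanSpace ℝ (Fin n), V y ≤ V x + ⟪gradient V x, y - x⟫ + Lam / 2 * ‖y - x‖ ^ 2)
    (hcrit : gradient V x₀ = 0) (y : EuclideanSpace ℝ (Fin n)) : V y ≤ V x₀ + Lam / 2 * ‖y - x₀‖ ^ 2 := by
  have := hVup x₀ y
  rwa [hcrit, inner_zero_left, add_zero] at this

/-- **THE BALL ABOUT THE MINIMISER CARRIES ALL BUT THE FRACTION `η`** = the OWNER's `…ConvexWindowMass.ballMass_ge_of_pinch` BY NAME,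
with its displayed `x₀` and `hlow` SUPPLIED by `exists_minimiser_of_firstOrder` and `hup` derived at the critical point from the
two-sided first-order letters (`λ`-convexity below, `Λ`-smoothness above, both for ALL `x, y` — the consumer need not know `x₀`):
`∃ x₀, ∇V x₀ = 0 ∧ (1 − η)·∫e^{−V} ≤ ∫_{‖y − x₀‖ < R} e^{−V}`, `η = e^{−λR²∕4}(π∕(λ∕4))^{d∕2}∕(π∕(Λ∕2))^{d∕2}`. [folklore] -/
theorem exists_ballMass_ge_of_firstOrder_pinch {V : EuclideanSpace ℝ (Fin n) → ℝ} {lam Lam R : ℝ} (hlam : 0 < lam)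
    (hLam : 0 < Lam) (hR : 0 ≤ R) (hVc : Continuous V)
    (hV : ∀ x y : EuclideanSpace ℝ (Fin n), V x + ⟪gradient V x, y - x⟫ + lam / 2 * ‖y - x‖ ^ 2 ≤ V y)
    (hVup : ∀ x y : EuclideanSpace ℝ (Fin n), V y ≤ V x + ⟪gradient V x, y - x⟫ + Lam / 2 * ‖y - x‖ ^ 2)
    (hZ : Integrable fun y => exp (-V y)) :
    ∃ x₀ : EuclideanSpace ℝ (Fin n), gradient V x₀ = 0 ∧
      (1 - exp (-(lam * R ^ 2 / 4)) * (π / (lam / 4)) ^ (Module.finrank ℝ (EuclideanSpace ℝ (Fin n)) / 2 : ℝ) /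
          (π / (Lam / 2)) ^ (Module.finrank ℝ (EuclideanSpace ℝ (Fin n)) / 2 : ℝ)) * ∫ y, exp (-V y) ≤
        ∫ y in {y | ‖y - x₀‖ < R}, exp (-V y) := by
  obtain ⟨x₀, hcrit, hlow⟩ := exists_minimiser_of_firstOrder hlam hVc hV
  exact ⟨x₀, hcrit, ConvexWindowMass.ballMass_ge_of_pinch hlam hLam hR x₀ hlow
    (forall_upperPinch_of_gradient_eq_zero hVup hcrit) hZ⟩



end Summit.QuantumFields.BalabanUV.T4Continuum.NE7b.ConvexMinimiserBall

end
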